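import Mathlib.Geometry.Manifold.MFDeriv.Atlas
import Mathlib.Geometry.Manifold.IsManifold.Basic
import Literature.AlgebraicGeometry.ShimuraVarieties.UnitaryBallQuotientDatum
import Literature.AlgebraicGeometry.HodgeTheory.RationalHodgeClasses
import Literature.NumberTheory.Transcendental.AnalytificationFunctorialityProofs
import Literature.Analysis.Complex.InjectiveHolomorphic
import HarnessLib

/-!
# The uniformization of a ball quotient is holomorphic in every Hodge model

Stub `stub_unifHolomorphic` (sub-stub B of the construction S2b "the Hecke graph is analytic") of
the crux `EndoscopicMiddleDegree.OrthogonalEnveloped` (line `purity-sorted-hecke-envelope`).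

For a unitary ball quotient datum `D` on `X` (so `D.unif : ℂ^{p+1} → X(ℂ)` presents
`X(ℂ) = Γ \ 𝔹` on the open negative cone `D.cone`, continuously and holomorphically *in algebraic
coordinates*: regular functions on affine opens pull back to holomorphic functions, field
`differentiableOn_unif`) and a Hodge model `A` of `X` (a complex manifold `A.carrier` with
`A.toComplexPoints : A.carrier → X(ℂ)` THE analytification of `X`), the map
`A.toComplexPoints⁻¹ ∘ D.unif : D.cone → A.carrier` is holomorphic.

This is the universal property of the analytification "into" (Serre, GAGA §2 n°5): a continuous
map `f` into `X^an` such that every regular function of `X` is holomorphic along `f` is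
holomorphic. We prove it in the general form
`mdifferentiableAt_of_isAnalytification_of_comp_eq` by the argument of the tree's
`Literature.NumberTheory.Transcendental.IsAnalytification.mdifferentiable_comp_map_holds`
(same file layout, Steps 1–5): near `f x`, among the pulled-back coordinate functions of a
standard smooth affine chart `V ∋ (ψ (f x)).pt` of `X`, the free ones are injective (uniqueness
half of the implicit function theorem, `exists_isOpen_injOn_of_det_ne_zero`), hence form a
holomorphic chart of the manifold by the Clements–Osgood theorem
(`Literature.Analysis.Complex.SCV.bijective_fderiv_of_injOn`); read in this chart, `f` is the
tuple of free coordinates along `u = ψ ∘ f`, holomorphic by hypothesis.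
-/

noncomputable section

set_option linter.dupNamespace false

namespace Summit.HodgeConjecture.HodgeConjecture.Cruxes.OrthogonalEnveloped.HeckeGraphChow

open scoped Manifold ContDiff Topology
open CategoryTheory AlgebraicGeometry Filter
open Literature.AlgebraicGeometry.Motives (SchemeOver ComplexPoints IsSmoothProjective AlgPoints)
open Literature.AlgebraicGeometry.HodgeTheory (HodgeModel)
open Literature.AlgebraicGeometry.ShimuraVarieties
open Literature.NumberTheory.Transcendental (IsAnalytification exists_isOpen_injOn_of_det_ne_zero)

/-- **Universal property of the analytification, "into" direction** (Serre, GAGA §2 n°5: the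
analytic structure of `X^h` is characterised by its regular functions being holomorphic). Let
`ψ : M' → Y(ℂ)` be an analytification, with holomorphic atlas, of the smooth `k`-scheme `Y` of
relative dimension `e`, and let `f : F → M'` (source a complex normed space) be continuous at `x`
and such that, with `u = ψ ∘ f`, every regular function `s ∈ Γ(Y, V)` on an affine open
`V ∋ u(x)` is complex-differentiable at `x` along `u`. Then `f` is complex-differentiable at `x`.
Proof: Steps 1–5 of `IsAnalytification.mdifferentiable_comp_map_holds` with the source map `u`
(free coordinates of a standard smooth presentation of `V` are injective near `f x` by the
implicit function theorem, hence a holomorphic chart by Clements–Osgood; in it `f` reads as the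
tuple of free coordinates along `u`).
[cite: SerreGAGA1956, §2 n°5] [cite: FritzscheGrauert2002, Ch. I §8 Cor. 8.6] -/
-- adapted from Literature.NumberTheory.Transcendental.IsAnalytification.mdifferentiable_comp_map_holds
theorem mdifferentiableAt_of_isAnalytification_of_comp_eq
    {E' : Type*} [NormedAddCommGroup E'] [NormedSpace ℂ E'] [FiniteDimensional ℂ E']
    {M' : Type*} [TopologicalSpace M'] [ChartedSpace E' M'] [IsManifold 𝓘(ℂ, E') ω M']
    {k : Type} [Field k] [Algebra k ℂ] {Y : SchemeOver k} {e : ℕ}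
    [SmoothOfRelativeDimension e Y.hom]
    {ψ : M' → ComplexPoints Y} (hψ : IsAnalytification E' Y e ψ)
    {F : Type*} [NormedAddCommGroup F] [NormedSpace ℂ F]
    {f : F → M'} {u : F → ComplexPoints Y} {x : F}
    (hcont : ContinuousAt f x) (hfu : ∀ y, ψ (f y) = u y)
    (hu : ∀ (V : Y.left.affineOpens) (s : Γ(Y.left, ↑V)), (u x).pt ∈ (↑V : Y.left.Opens) →
      DifferentiableAt ℂ (fun y ↦ AlgPoints.evalOrZero (↑V : Y.left.Opens) s (u y)) x) :
    MDifferentiableAt 𝓘(ℂ, F) 𝓘(ℂ, E') f x := by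
  classical
  haveI : IsManifold 𝓘(ℂ, E') 1 M' := inferInstance
  haveI : CompleteSpace E' := FiniteDimensional.complete ℂ E'
  have hψinj : Function.Injective ψ := hψ.isHomeomorph.injective
  /- Step 1: a standard smooth presentation `Γ(Y, V) = k[Xᵢ]/(fⱼ)` on an affine open `V`
  containing `(ψ (f x)).pt` (the base affine open is all of `Spec k`, a one-point space). -/
  obtain ⟨U', _, V, hV, hyV, eVU, hstd⟩ :=
    SmoothOfRelativeDimension.exists_isStandardSmoothOfRelativeDimension (n := e) (f := Y.hom)
      (ψ (f x)).pt
  obtain rfl : U' = ⊤ := by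
    refine eq_top_iff.2 fun q _ ↦ ?_
    have hy : Y.hom.base (ψ (f x)).pt ∈ U' := eVU hyV
    rwa [Subsingleton.elim q (Y.hom.base (ψ (f x)).pt)]
  letI alg : Algebra Γ(Spec (.of k), ⊤) Γ(Y.left, V) := (Y.hom.appLE ⊤ V eVU).hom.toAlgebra
  have halg : algebraMap Γ(Spec (.of k), ⊤) Γ(Y.left, V) = (Y.hom.appLE ⊤ V eVU).hom := rfl
  obtain ⟨ι, σ, _, _, P, hPdim⟩ := hstd.toAlgebra.out
  cases nonempty_fintype ι
  cases nonempty_fintype σ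
  -- the relations over `ℂ` and the coordinate functions on `Y(ℂ)`
  set Fr : σ → MvPolynomial ι ℂ := fun j ↦
    MvPolynomial.map ((algebraMap k ℂ).comp (Scheme.ΓSpecIso (.of k)).hom.hom) (P.relation j)
    with hFr
  set xf : ι → ComplexPoints Y → ℂ := fun i ↦ AlgPoints.evalOrZero V (P.val i) with hxf
  set Q : ComplexPoints Y := ψ (f x) with hQdef
  have hQV : Q.pt ∈ V := hyV
  /- Step 2 (algebra): `x : V(ℂ) → ℂ^ι` is injective, lands in the zero set of the `Fr j`, and
  the Jacobian of the `Fr j` in the distinguished variables does not vanish at `x(Q)`. -/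
  have hrel : ∀ R : ComplexPoints Y, R.pt ∈ V →
      ∀ j, MvPolynomial.eval (fun i ↦ xf i R) (Fr j) = 0 := by
    intro R hR j
    have := AlgPoints.eval_map_relation eVU halg P.toPresentation R hR j
    simp only [hxf, AlgPoints.evalOrZero_of_mem _ hR]
    exact this
  have hinjV : ∀ R R' : ComplexPoints Y, R.pt ∈ V → R'.pt ∈ V →
      (∀ i, xf i R = xf i R') → R = R' := by
    intro R R' hR hR' hx
    refine AlgPoints.ext_of_forall_eval_val_eq hV eVU halg P.toGenerators hR hR' fun i ↦ ?_
    have := hx i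
    simp only [hxf] at this
    rwa [AlgPoints.evalOrZero_of_mem _ hR, AlgPoints.evalOrZero_of_mem _ hR'] at this
  have hdet : (Matrix.of fun i j : σ ↦ MvPolynomial.eval (fun l ↦ xf l Q)
      (MvPolynomial.pderiv (P.map i) (Fr j))).det ≠ 0 := by
    have := AlgPoints.det_eval_pderiv_relation_ne_zero eVU halg P Q hQV
    simp only [hxf, AlgPoints.evalOrZero_of_mem _ hQV]
    exact this
  /- Step 3 (implicit functions): near `x(Q)`, points of `ℂ^ι` in the zero set are determined by
  their free coordinates; hence the free coordinates `xᵢ ∘ ψ`, `i ∉ c(σ)`, are injective on a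
  neighbourhood `N₁` of `f x` in `M'`. -/
  obtain ⟨W, hWo, hcW, hWinj⟩ :=
    exists_isOpen_injOn_of_det_ne_zero P.map P.map_inj Fr (fun l ↦ xf l Q) hdet
  set N₁ : Set M' := ψ ⁻¹' {R | R.pt ∈ V} ∩ (fun m'' ↦ fun l ↦ xf l (ψ m'')) ⁻¹' W with hN₁
  have hN₁o : IsOpen N₁ := by
    refine ContinuousOn.isOpen_inter_preimage ?_ (hψ.isOpen_preimage V) hWo
    refine continuousOn_pi.2 fun l ↦ ?_
    exact (AlgPoints.continuousOn_evalOrZero V (P.val l)).comp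
      hψ.isHomeomorph.continuous.continuousOn fun m'' hm'' ↦ hm''
  have hmN₁ : f x ∈ N₁ := ⟨hQV, hcW⟩
  have hinjN₁ : ∀ m₁ ∈ N₁, ∀ m₂ ∈ N₁,
      (∀ i : {i : ι // i ∉ Set.range P.map}, xf i.1 (ψ m₁) = xf i.1 (ψ m₂)) → m₁ = m₂ := by
    intro m₁ hm₁ m₂ hm₂ hfree
    apply hψinj
    refine hinjV _ _ hm₁.1 hm₂.1 fun i ↦ ?_
    have key := hWinj _ hm₁.2 _ hm₂.2 (fun i hi ↦ hfree ⟨i, hi⟩)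
      (fun j ↦ by rw [hrel _ hm₁.1, hrel _ hm₂.1])
    exact congrFun key i
  /- Step 4 (Osgood): in the chart `χ'` of `M'` at `f x`, `T = x_free ∘ ψ ∘ χ'⁻¹` is an
  injective holomorphic map between open subsets of `e`-dimensional spaces, so its differential
  at `χ' (f x)` is invertible and `T` has a holomorphic local inverse. -/
  set χ' : OpenPartialHomeomorph M' E' := chartAt E' (f x) with hχ'
  set O : Set E' := χ'.target ∩ χ'.symm ⁻¹' N₁ with hO
  have hOo : IsOpen O := χ'.isOpen_inter_preimage_symm hN₁o
  set T : E' → ({i : ι // i ∉ Set.range P.map} → ℂ) :=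
    fun z i ↦ xf i.1 (ψ (χ'.symm z)) with hT
  have hz₀ : χ' (f x) ∈ O :=
    ⟨χ'.map_source (mem_chart_source E' (f x)), by
      show χ'.symm (χ' (f x)) ∈ N₁
      rw [χ'.left_inv (mem_chart_source E' (f x))]
      exact hmN₁⟩
  have hyM' : ∀ i, MDifferentiableOn 𝓘(ℂ, E') 𝓘(ℂ, ℂ) (fun m'' ↦ xf i (ψ m''))
      (ψ ⁻¹' {R | R.pt ∈ V}) :=
    fun i ↦ hψ.mdifferentiableOn_evalOrZero ⟨V, hV⟩ (P.val i)
  have hTd : DifferentiableOn ℂ T O := by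
    intro z hz
    suffices hd : DifferentiableAt ℂ T z from hd.differentiableWithinAt
    refine differentiableAt_pi.2 fun i ↦ ?_
    have h1 : MDifferentiableAt 𝓘(ℂ, E') 𝓘(ℂ, ℂ) (fun m'' ↦ xf i.1 (ψ m'')) (χ'.symm z) :=
      (hyM' i.1).mdifferentiableAt ((hψ.isOpen_preimage _).mem_nhds hz.2.1)
    have h2 : MDifferentiableAt 𝓘(ℂ, E') 𝓘(ℂ, E') χ'.symm z :=
      mdifferentiableAt_atlas_symm (chart_mem_atlas E' (f x)) hz.1
    exact mdifferentiableAt_iff_differentiableAt.1 (h1.comp z h2)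
  have hTinj : Set.InjOn T O := by
    intro z hz z' hz' hzz'
    have : χ'.symm z = χ'.symm z' := hinjN₁ _ hz.2 _ hz'.2 fun i ↦ congrFun hzz' i
    rw [← χ'.right_inv hz.1, ← χ'.right_inv hz'.1, this]
  have hcard : Fintype.card {i : ι // i ∉ Set.range P.map} = e := by
    rw [Fintype.card_subtype_compl]
    change Fintype.card ι - Fintype.card (Set.range P.map) = e
    rw [Set.card_range_of_injective P.map_inj, ← hPdim, Algebra.Presentation.dimension,
      Nat.card_eq_fintype_card, Nat.card_eq_fintype_card]
  have hdim : Module.finrank ℂ E' = Module.finrank ℂ ({i : ι // i ∉ Set.range P.map} → ℂ) := by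
    rw [hψ.finrank_eq, Module.finrank_fintype_fun_eq_card, hcard]
  have hbij := Literature.Analysis.Complex.SCV.bijective_fderiv_of_injOn hdim hTd hOo hTinj hz₀
  set Λ : E' ≃L[ℂ] ({i : ι // i ∉ Set.range P.map} → ℂ) :=
    ContinuousLinearEquiv.ofBijective (fderiv ℂ T (χ' (f x))) (LinearMap.ker_eq_bot.2 hbij.1)
      (LinearMap.range_eq_top.2 hbij.2) with hΛ
  have hstrict : HasStrictFDerivAt T (Λ : E' →L[ℂ] _) (χ' (f x)) := by
    rw [hΛ, ContinuousLinearEquiv.coe_ofBijective]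
    exact ((Literature.Analysis.Complex.SCV.contDiffOn_one hTd hOo).contDiffAt
      (hOo.mem_nhds hz₀)).hasStrictFDerivAt one_ne_zero
  /- Step 5: `A = x_free ∘ u` is holomorphic at `x` by hypothesis (`u x = Q ∈ V(ℂ)`), and near
  `x`, `f = χ'⁻¹ ∘ T⁻¹ ∘ A`. -/
  set A : F → ({i : ι // i ∉ Set.range P.map} → ℂ) := fun y i ↦ xf i.1 (u y) with hA
  have huxV : (u x).pt ∈ V := by
    rw [← hfu]
    exact hQV
  have hAd : MDifferentiableAt 𝓘(ℂ, F) 𝓘(ℂ, {i : ι // i ∉ Set.range P.map} → ℂ) A x :=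
    mdifferentiableAt_iff_differentiableAt.2
      (differentiableAt_pi.2 fun i ↦ hu ⟨V, hV⟩ (P.val i.1) huxV)
  have hTA : ∀ y, f y ∈ χ'.source → T (χ' (f y)) = A y := by
    intro y hy
    funext i
    simp only [hT, hA, χ'.left_inv hy, hfu]
  have hev : f =ᶠ[𝓝 x] fun y ↦ χ'.symm (hstrict.localInverse T _ _ (A y)) := by
    have h1 : ∀ᶠ y in 𝓝 x, f y ∈ χ'.source :=
      hcont.preimage_mem_nhds (χ'.open_source.mem_nhds (mem_chart_source E' (f x)))
    have h2 : ∀ᶠ y in 𝓝 x, hstrict.localInverse T _ _ (T (χ' (f y))) = χ' (f y) := by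
      have hc : ContinuousAt (fun y ↦ χ' (f y)) x :=
        (χ'.continuousAt (mem_chart_source E' (f x))).comp hcont
      exact hc.eventually hstrict.eventually_left_inverse
    filter_upwards [h1, h2] with y hy1 hy2
    rw [← hTA y hy1, hy2, χ'.left_inv hy1]
  refine MDifferentiableAt.congr_of_eventuallyEq ?_ hev
  have hTm : T (χ' (f x)) = A x := hTA x (mem_chart_source E' (f x))
  have h1 : MDifferentiableAt 𝓘(ℂ, {i : ι // i ∉ Set.range P.map} → ℂ) 𝓘(ℂ, E')
      (hstrict.localInverse T _ _) (A x) := by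
    rw [← hTm]
    exact mdifferentiableAt_iff_differentiableAt.2
      hstrict.to_localInverse.hasFDerivAt.differentiableAt
  have h2 : MDifferentiableAt 𝓘(ℂ, E') 𝓘(ℂ, E') χ'.symm (hstrict.localInverse T _ _ (A x)) := by
    rw [← hTm, hstrict.localInverse_apply_image]
    exact mdifferentiableAt_atlas_symm (chart_mem_atlas E' (f x))
      (χ'.map_source (mem_chart_source E' (f x)))
  exact h2.comp x (h1.comp x hAd)

/-- **Stub B (`stub_unifHolomorphic`, c2-registered) — the uniformization is holomorphic in the Hodge model.**
For a datum `D` on `X` and a Hodge model `A` of `X`, `A.toComplexPoints⁻¹ ∘ unif` is complex-differentiable on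
the negative cone (regular functions pull back to holomorphic functions along `unif`, field
`differentiableOn_unif`; along `A.toComplexPoints` they give local holomorphic charts by Clements–Osgood —
the tree's `IsAnalytification.mdifferentiable_comp_map_holds` argument,
`mdifferentiableAt_of_isAnalytification_of_comp_eq`). [cite: SerreGAGA1956, §2 n°5]
[cite: BergeronMillsonMoeglin2016Balls, Part 2 §1.4] -/
theorem stub_unifHolomorphic :
    ∀ {p : ℕ} {X : SchemeOver ℂ} (D : UnitaryBallQuotientDatum p X) (A : HodgeModel p X),
      MDifferentiableOn 𝓘(ℂ, Fin (p + 1) → ℂ) 𝓘(ℂ, A.model)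
        (fun v ↦ A.isAnalytification.isHomeomorph.homeomorph.symm (D.unif v)) D.cone := by
  intro p X D A v hv
  haveI : SmoothOfRelativeDimension p X.hom := D.isSmoothProjective.smoothOfRelativeDimension
  have hcone : D.cone ∈ 𝓝 v := (isOpen_negCone _).mem_nhds hv
  have hc : ContinuousAt D.unif v := D.continuousOn_unif.continuousAt hcone
  refine (mdifferentiableAt_of_isAnalytification_of_comp_eq A.isAnalytification
    ((A.isAnalytification.isHomeomorph.homeomorph.symm.continuous.continuousAt).comp hc)
    (fun w ↦ A.isAnalytification.isHomeomorph.homeomorph.apply_symm_apply (D.unif w))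
    fun V s hV ↦ ?_).mdifferentiableWithinAt
  have ho : IsOpen (D.cone ∩ D.unif ⁻¹' {P | P.pt ∈ (↑V : X.left.Opens)}) :=
    D.continuousOn_unif.isOpen_inter_preimage (isOpen_negCone _) (AlgPoints.isOpen_setOf_pt_mem _)
  exact (D.differentiableOn_unif V s).differentiableAt (ho.mem_nhds ⟨hv, hV⟩)

end Summit.HodgeConjecture.HodgeConjecture.Cruxes.OrthogonalEnveloped.HeckeGraphChow

end
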